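import Summits.HodgeConjecture.HodgeConjecture.Theorems.Ring2HypothesesDescentMotivatedDeformationProjectiveBase
import Summits.HodgeConjecture.HodgeConjecture.Theorems.Ring2HypothesesDescentAlgebraicQuasiInverseRows
import Summits.HodgeConjecture.HodgeConjecture.Theorems.Ring2HypothesesDescentStandardBStrictAbelian
import Summits.HodgeConjecture.HodgeConjecture.Theorems.Ring2AbelianAllConstantPencils
import Literature.AlgebraicGeometry.Andre1996.AbsoluteHodgeClassesFromMotivated
import HarnessLib

/-!
# Ring 2 hypotheses, descent face — two sets of consequences of gen 42: Deligne's Main Theorem 2.11 by André's route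
# WITHOUT Théorème 0.5 (c24) / Prop. 2.1 (ii); and the β-node on the compact abelian pencils whose total space is
# dominated by the powers of an abelian variety (constant pencils first)

research route conditional on HC_CM; not a corollary; Q11.4-sentence-2 already refuted in dim ≥ 3.
Cell `pub-hodge-ring2` (Hodge ladder STAGE 3), seat `ring2-b05` (binder row b05
`Ring2.Hypotheses.MotivatedImpliesAlgebraicAV`), gen 42, P.S.; sequel of `…MotivatedDeformationProjectiveBase` (Thm. 0.5 over
smooth projective bases fact-free; c2 ⟸ c11 ∧ c12) and `…AlgebraicQuasiInverseRows` (the β-column with no supply node).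
`HC_CM` does not occur in this file; no node and no binder of record is discharged.

* §1 DELIGNE 1982 MAIN THM. 2.11 (c1 `deligne1982_hodgeClasses_abelianVariety_absoluteHodge`: Hodge classes on complex abelian
  varieties are absolute Hodge) BY ANDRÉ'S ROUTE («0.6.2 … renforce le théorème de Deligne», p. 9), now modulo André's
  Lemmes 6.3.1–6.3.3 (c11, c12) and Prop. 2.5.1 (`Andre1996_isAbsoluteHodgeClass_of_mem_motivatedClasses`) ONLY — the
  literature seat's `deligne1982_hodgeClasses_abelianVariety_absoluteHodge_of_andre1996_pencils` with its binders
  `h05 : Andre1996_deformation` (c24) and `hpb : Andre1996_motivatedClasses_pullback` DELETED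
  (`deligne1982_hodgeClasses_abelianVariety_absoluteHodge_of_andre1996_pencils'`); the CM case modulo {c12, Prop. 2.5.1}
  (`isAbsoluteHodgeClass_of_isOfCMType_of_andre1996'`); and the `ℚ̄`-reduction of `HC` for abelian varieties along
  André's chain modulo {c11, c12, Prop. 2.5.1, Voisin 2007 Prop. 1.2}
  (`hodgeConjectureFor_abelianVariety_of_hodgeConjectureFor_qbar_of_andre1996_pencils'`).
* §2 THE β-NODE ON THE STRICT ABELIAN CLASS OF TOTAL SPACES, UNCONDITIONALLY: (β′_f) / (A_f) / (β′ᵖᵗ_f) and the algebraic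
  Leray idempotents for every compact pencil of abelian varieties whose TOTAL SPACE is dominated by the powers of an
  abelian variety (`fibreClassLefschetzOn_of_exists_isDominatedByPowers_abelianVariety_total`: gen 41's
  `standardConjectureBStar_total_of_exists_isDominatedByPowers_abelianVariety` fed into the supply-free row
  `fibreClassLefschetzOn_of_lefschetzB`), in particular for the CONSTANT pencils `A × C → C`
  (`fibreClassLefschetzOn_snd`, the sub-cell's first inhabitants of `IsCompactAbelianPencil`, ab-andre-1 part IV —
  which recorded the β-type nodes on constant pencils as «true … but not needed here», unproved). This is the
  ISOTRIVIAL-type half of the β-column; ab-andre-2's divisor-spanned habitat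
  (`algebraicFibreClassQuasiInverseOn_relDim_two_of_divisorSpan`) is the other half at `d = 2`.

No definition, no named fact, no sorry. References: Andre1996Motifs (Thm. 0.6.2 with footnote (1) p. 9, Prop. 2.5.1 p. 18,
§6.3 pp. 31–33), Deligne1982HodgeCycles (Main Thm. 2.11 p. 19), Voisin2007HodgeLoci (Prop. 1.2), Abdulali1994FamiliesAV
(Conj. 5.3, Thm. 5.5 p. 1130), Arapura2006 (§4 Lemma 4.2), Lieberman1968 (main theorem).
-/

noncomputable section

-- every declaration of this problem lives in `Summit.HodgeConjecture.HodgeConjecture.…` (summit = sub-problem)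
set_option linter.dupNamespace false

open CategoryTheory AlgebraicGeometry MonoidalCategory
open Literature.AlgebraicGeometry Literature.AlgebraicGeometry.Motives
  Literature.AlgebraicGeometry.HodgeTheory
open Literature.AlgebraicGeometry.Milne1999 (IsOfCMType)
open Literature.AlgebraicGeometry.Andre1996 (andre1996_cmAnchoredPencil andre1996_cmHodgeClasses_algebraicallyAnchoredPencils
  deligne1982_hodgeClasses_abelianVariety_absoluteHodge_of_andre1996
  hodgeConjectureFor_abelianVariety_of_hodgeConjectureFor_qbar_of_andre1996)
open Summit.HodgeConjecture.HodgeConjecture.Ring2.AbelianAll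

namespace Summit.HodgeConjecture.HodgeConjecture.Theorems

/-! ## §1 Deligne's Main Theorem 2.11 by André's route, without Théorème 0.5 -/

/-- **DELIGNE 1982, MAIN THM. 2.11 (c1) from André's printed ingredients, modulo Lemmes 6.3.1–6.3.3 (c11, c12) and Prop. 2.5.1
only**: every rational `(p,p)` class on every complex abelian variety is an absolute Hodge class — the literature seat's
`deligne1982_hodgeClasses_abelianVariety_absoluteHodge_of_andre1996_pencils` with Thm. 0.5 supplied by the fact-free
projective-base theorem (through `andre1996_hodgeClasses_abelianVariety_motivated_of_pencils'`) and Prop. 2.1 (ii) by gen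
34's theorem. NOT a discharge of c1 (three named facts displayed).
[cite: Andre1996Motifs, Thm. 0.6.2 with footnote (1) (p. 9) and Prop. 2.5.1 (p. 18)] [cite: Deligne1982HodgeCycles, Main Thm. 2.11 (p. 19)] -/
theorem deligne1982_hodgeClasses_abelianVariety_absoluteHodge_of_andre1996_pencils' (h₁ : andre1996_cmAnchoredPencil)
    (h₂ : andre1996_cmHodgeClasses_algebraicallyAnchoredPencils)
    (hAH : Andre1996_isAbsoluteHodgeClass_of_mem_motivatedClasses) :
    deligne1982_hodgeClasses_abelianVariety_absoluteHodge :=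
  deligne1982_hodgeClasses_abelianVariety_absoluteHodge_of_andre1996
    (andre1996_hodgeClasses_abelianVariety_motivated_of_pencils' h₁ h₂) hAH

/-- **Hodge classes on abelian varieties of CM type are absolute Hodge, modulo Lemmes 6.3.2–6.3.3 (c12) and Prop. 2.5.1
only** (the literature seat's `isAbsoluteHodgeClass_of_isOfCMType_of_andre1996` without `h05` / `hpb`; Deligne's §5 step
by André's route). [cite: Andre1996Motifs, §6.3 b), c) (pp. 32–33) and Prop. 2.5.1 (p. 18)]
[cite: Deligne1982HodgeCycles, §5 and Main Thm. 2.11 (p. 19)] -/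
theorem isAbsoluteHodgeClass_of_isOfCMType_of_andre1996' (h₂ : andre1996_cmHodgeClasses_algebraicallyAnchoredPencils)
    (hAH : Andre1996_isAbsoluteHodgeClass_of_mem_motivatedClasses) (B : AbelianVariety ℂ) (hCM : IsOfCMType B) (p : ℕ)
    (c : complexBetti B.X (2 * p)) (hc : IsRationalClass c) (hpp : IsOfHodgeType B.dim B.X (2 * p) p p c) :
    IsAbsoluteHodgeClass B.dim B.X p c :=
  hAH AbelianVariety.isSmoothProjective_holds p c hc
    (mem_motivatedClasses_of_isOfCMType_of_pencils h₂ B AbelianVariety.isSmoothProjective_holds hCM p c hc hpp)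

/-- **The `ℚ̄`-reduction of the Hodge conjecture for complex abelian varieties along André's chain, modulo {c11, c12,
Prop. 2.5.1, Voisin 2007 Prop. 1.2}** (the literature seat's `…_of_andre1996_pencils` row without `h05` / `hpb`): HC for the
`ℚ̄`-definable smooth projective complex varieties implies `HodgeConjectureFor A.dim A.X` for every complex abelian variety.
[cite: Voisin2007HodgeLoci, Prop. 1.2] [cite: Andre1996Motifs, Thm. 0.6.2 (p. 9), Prop. 2.5.1 (p. 18), §6.3 (pp. 31–33)] -/
theorem hodgeConjectureFor_abelianVariety_of_hodgeConjectureFor_qbar_of_andre1996_pencils'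
    (h₁ : andre1996_cmAnchoredPencil) (h₂ : andre1996_cmHodgeClasses_algebraicallyAnchoredPencils)
    (hAH : Andre1996_isAbsoluteHodgeClass_of_mem_motivatedClasses) (hV : voisin2007_hodgeConjecture_absolute_of_qbar)
    (hQ : ∀ (σ : AlgebraicClosure ℚ →+* ℂ) ⦃n : ℕ⦄ ⦃X₀ : SchemeOver (AlgebraicClosure ℚ)⦄,
      IsSmoothProjective n ((baseChangeHom σ).obj X₀) → HodgeConjectureFor n ((baseChangeHom σ).obj X₀))
    (A : AbelianVariety ℂ) : HodgeConjectureFor A.dim A.X :=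
  hodgeConjectureFor_abelianVariety_of_hodgeConjectureFor_qbar_of_andre1996
    (andre1996_hodgeClasses_abelianVariety_motivated_of_pencils' h₁ h₂) hAH hV hQ A

/-! ## §2 The β-node on compact abelian pencils with a dominated total space — unconditionally -/

section Pencils

variable {𝒳 S : SchemeOver ℂ}

/-- **(β′_f) UNCONDITIONALLY on every compact pencil of abelian varieties whose total space is dominated by the powers of an
abelian variety** (Arapura's strict abelian class: `B⋆(𝒳)` is gen 41's theorem, then the supply-free row
`fibreClassLefschetzOn_of_lefschetzB`): the cup product with the fibre class has an algebraic quasi-inverse on fibre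
restrictions, in every degree `2p ≤ 2d`. [cite: Abdulali1994FamiliesAV, Conjecture 5.3 and Theorem 5.5 (p. 1130)]
[cite: Arapura2006, §4 Lemma 4.2] [cite: Lieberman1968, main theorem] -/
theorem fibreClassLefschetzOn_of_exists_isDominatedByPowers_abelianVariety_total {d : ℕ} {f : 𝒳 ⟶ S}
    (hf : IsCompactAbelianPencil f d) (h : ∃ A : AbelianVariety ℂ, IsDominatedByPowers (d + 1) 𝒳 A.dim A.X) :
    FibreClassLefschetzOn hf :=
  fibreClassLefschetzOn_of_lefschetzB hf (standardConjectureBStar_total_of_exists_isDominatedByPowers_abelianVariety hf h)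

/-- (A_f) — ONE algebraic quasi-inverse of the cup product with the fibre class serving every fibre — unconditionally on
the same pencils. [cite: Abdulali1994FamiliesAV, Remark 5.4 and Theorem 5.5 (p. 1130)] [cite: Arapura2006, §4 Lemma 4.2] -/
theorem algebraicFibreClassQuasiInverseOn_of_exists_isDominatedByPowers_abelianVariety_total {d : ℕ} {f : 𝒳 ⟶ S}
    (hf : IsCompactAbelianPencil f d) (h : ∃ A : AbelianVariety ℂ, IsDominatedByPowers (d + 1) 𝒳 A.dim A.X) :
    AlgebraicFibreClassQuasiInverseOn hf :=
  algebraicFibreClassQuasiInverseOn_of_lefschetzB hf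
    (standardConjectureBStar_total_of_exists_isDominatedByPowers_abelianVariety hf h)

/-- Algebraic Leray idempotents with (Π1), (π), (κ) in every degree `2p ≤ 2d`, at every point, unconditionally on the same
pencils. [cite: DeligneHodgeII1971, Thm. 4.1.1] [cite: Arapura2006, §4 Lemma 4.2] -/
theorem exists_lerayIdempotentC_of_exists_isDominatedByPowers_abelianVariety_total {d : ℕ} {f : 𝒳 ⟶ S}
    (hf : IsCompactAbelianPencil f d) (h : ∃ A : AbelianVariety ℂ, IsDominatedByPowers (d + 1) 𝒳 A.dim A.X)
    (t : ComplexPoints S) {p : ℕ} (hp : p ≤ d) :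
    ∃ e : complexBetti 𝒳 (2 * p) →ₗ[ℂ] complexBetti 𝒳 (2 * p),
      IsAlgebraicCorrespondence (d + 1) (d + 1) 𝒳 𝒳 e ∧
      (∀ w, complexBetti.map (fiberι f t) (2 * p) (e w) = complexBetti.map (fiberι f t) (2 * p) w) ∧
      (∀ w, complexBetti.map (fiberι f t) (2 * p) w = 0 → e w = 0) :=
  exists_lerayIdempotentC_of_lefschetzB hf (standardConjectureBStar_total_of_exists_isDominatedByPowers_abelianVariety hf h)
    t hp

/-- **Surjective-image form**: if the total space receives a surjective morphism from a smooth projective `Z` in the strict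
abelian class (e.g. `Z = A × S'` for a pencil that becomes constant after a finite base change `S' → S` — the isotrivial
pencils), then (β′_f) holds. [cite: Arapura2006, §1 Cor. 1.2 and §4 Lemma 4.2] [cite: Abdulali1994FamiliesAV, Theorem 5.5 (p. 1130)] -/
theorem fibreClassLefschetzOn_of_surjective_of_exists_isDominatedByPowers_abelianVariety {d dZ : ℕ} {f : 𝒳 ⟶ S}
    {Z : SchemeOver ℂ} (hf : IsCompactAbelianPencil f d) (hZ : IsSmoothProjective dZ Z) (g : Z ⟶ 𝒳)
    [AlgebraicGeometry.Surjective g.left] (h : ∃ B : AbelianVariety ℂ, IsDominatedByPowers dZ Z B.dim B.X) :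
    FibreClassLefschetzOn hf :=
  fibreClassLefschetzOn_of_exists_isDominatedByPowers_abelianVariety_total hf
    (CorCM.Stage4.exists_isDominatedByPowers_of_surjective hZ hf.isSmoothProjective_total g h)

/-- **(β′_f) for the CONSTANT pencils `pr₂ : A × C ⟶ C`** (`A` a complex abelian variety, `C` a smooth projective curve —
the first inhabitants of `IsCompactAbelianPencil`, ab-andre-1 part IV `isCompactAbelianPencil_snd`), UNCONDITIONALLY: the
total space `A × C` lies in the strict abelian class (`B⋆(A × C)` from Lieberman and `B` for curves).
[cite: Abdulali1994FamiliesAV, Conjecture 5.3 (p. 1130)] [cite: Lieberman1968, main theorem]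
[cite: Kleiman1968AlgebraicCycles, §2 Cor. 2.5] -/
theorem fibreClassLefschetzOn_snd (A : AbelianVariety ℂ) {C : SchemeOver ℂ} (hC : IsSmoothProjective 1 C) :
    FibreClassLefschetzOn (isCompactAbelianPencil_snd A hC) := by
  refine fibreClassLefschetzOn_of_lefschetzB (isCompactAbelianPencil_snd A hC) fun η ↦ ?_
  obtain ⟨ηC, hηC⟩ := exists_isPolarizationClass hC
  exact standardConjectureBStar_abelianVariety_tensor A hC hηC (standardConjectureBStar_curve hC ηC) η

end Pencils

end Summit.HodgeConjecture.HodgeConjecture.Theorems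

end
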